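import Summits.Ventures.PercRepro.MSSplitProj
import Summits.Ventures.PercRepro.MSTightClosure

/-!
# FACT (M): in a split family of excess one, every coordinate is monochromatic on one side

proofs/P4-gen9.md §9, Step 2 of the proof of Theorem 10.1. Let `F = s ⊔ t` be split (no member of
`s` comparable with a member of `t`), with a down-closed difference family, Marica–Schönheim excess
one, and `{r}` a difference. Then one of the two sides is MONOCHROMATIC at `r`: all its members
contain `r`, or all its members avoid `r` (`monochromatic_side`).

Proof. The projection `F′ = proj r F` is tight with a down-closed difference family
(`tight_proj_of_split_excess_one`, `isDownSet_diffs_proj`), so Theorem D gives its addable class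
`M′ = addableSet u′ F′`, which is a member, with `μ ∩ M′`, `μ ∪ M′ ∈ F′` for every member `μ`
(`MSTightClosure`). Every `μ ∈ F′` has a LIFT in `F` (`μ` itself or `insert r μ`), and all its lifts
lie on one side (`onS μ`/`onT μ`, exclusive: two lifts are comparable). THE LIFTING RULE
(`lift_rule`): if `μ ⊆ μ′` in `F′` lie on different sides, then `μ` has no `0`-lift (`μ ∉ F`) and
`μ′` has no `r`-lift (`insert r μ′ ∉ F`). Three cases on the lifts of `M′`: both — then every `μ`
is on `M′`'s side (`μ ∩ M′ ⊆ μ ⊆ μ ∪ M′` would need two incompatible exceptions), so the other side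
is empty; only the `0`-lift — every member of the other side has only an `r`-lift, i.e. contains
`r`; only the `r`-lift — every member of the other side avoids `r`.
-/

namespace PercRepro.MSTight

open Finset
open scoped FinsetFamily

variable {α : Type*} [DecidableEq α]

/-- The difference family of the projection is down-closed when that of `F` is. -/
theorem isDownSet_diffs_proj {r : α} {F : Finset (Finset α)} (hD : IsDownSet (F \\ F)) :
    IsDownSet (proj r F \\ proj r F) := by
  intro W hW W' hW'
  rw [diffs_proj_eq, Finset.union_eq_left.2 (diffsY_subset_diffsX hD)] at hW ⊢
  rw [← diffs_filter_notMem, Finset.mem_filter] at hW ⊢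
  exact ⟨hD _ hW.1 _ hW', fun h => hW.2 (hW' h)⟩

/-- Members of the projection avoid `r` and lift to `F`. -/
theorem lift_of_mem_proj {r : α} {F : Finset (Finset α)} {μ : Finset α} (h : μ ∈ proj r F) :
    r ∉ μ ∧ (μ ∈ F ∨ insert r μ ∈ F) := by
  obtain ⟨B, hB, rfl⟩ := mem_proj.1 h
  refine ⟨Finset.notMem_erase r B, ?_⟩
  by_cases hr : r ∈ B
  · right; rw [Finset.insert_erase hr]; exact hB
  · left; rw [Finset.erase_eq_of_notMem hr]; exact hB

section Split

variable {F s t : Finset (Finset α)} {r : α}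

/-- `μ` lies on the side `s` (through one of its lifts). -/
def OnSide (s : Finset (Finset α)) (r : α) (μ : Finset α) : Prop := μ ∈ s ∨ insert r μ ∈ s

/-- A member of `F = s ∪ t` lifts to one side. -/
theorem onSide_or_onSide (hst : s ∪ t = F) {μ : Finset α} (hμ : μ ∈ F ∨ insert r μ ∈ F) :
    OnSide s r μ ∨ OnSide t r μ := by
  rcases hμ with h | h
  · rw [← hst] at h
    rcases Finset.mem_union.1 h with h | h
    · exact Or.inl (Or.inl h)
    · exact Or.inr (Or.inl h)
  · rw [← hst] at h
    rcases Finset.mem_union.1 h with h | h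
    · exact Or.inl (Or.inr h)
    · exact Or.inr (Or.inr h)

/-- The two sides are exclusive: two lifts of `μ` are comparable, hence never across. -/
theorem not_onSide_both (hdisj : Disjoint s t)
    (hcross : ∀ a ∈ s, ∀ b ∈ t, ¬ a ⊆ b ∧ ¬ b ⊆ a) {μ : Finset α} :
    ¬ (OnSide s r μ ∧ OnSide t r μ) := by
  rintro ⟨hs, ht⟩
  rcases hs with hs | hs <;> rcases ht with ht | ht
  · exact Finset.disjoint_left.1 hdisj hs ht
  · exact (hcross _ hs _ ht).1 (Finset.subset_insert r μ)
  · exact (hcross _ hs _ ht).2 (Finset.subset_insert r μ)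
  · exact Finset.disjoint_left.1 hdisj hs ht

/-- **The lifting rule.** If `μ ⊆ μ′` with `μ` on side `s` and `μ′` on side `t`, then `μ` has no
`0`-lift and `μ′` has no `r`-lift. -/
theorem lift_rule (hst : s ∪ t = F) (hdisj : Disjoint s t)
    (hcross : ∀ a ∈ s, ∀ b ∈ t, ¬ a ⊆ b ∧ ¬ b ⊆ a) {μ μ' : Finset α} (hsub : μ ⊆ μ')
    (hμ : OnSide s r μ) (hμ' : OnSide t r μ') : μ ∉ F ∧ insert r μ' ∉ F := by
  constructor
  · intro hμF
    -- `μ ∈ F` must lie in `s`; its superset `μ′`'s lift lies in `t`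
    have hμs : μ ∈ s := by
      rw [← hst] at hμF
      rcases Finset.mem_union.1 hμF with h | h
      · exact h
      · exact absurd ⟨hμ, Or.inl h⟩ (not_onSide_both hdisj hcross)
    rcases hμ' with h | h
    · exact (hcross _ hμs _ h).1 hsub
    · exact (hcross _ hμs _ h).1 (hsub.trans (Finset.subset_insert r μ'))
  · intro hμ'F
    have hμ't : insert r μ' ∈ t := by
      rw [← hst] at hμ'F
      rcases Finset.mem_union.1 hμ'F with h | h
      · exact absurd ⟨Or.inr h, hμ'⟩ (not_onSide_both hdisj hcross)
      · exact h
    rcases hμ with h | h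
    · exact (hcross _ h _ hμ't).1 (hsub.trans (Finset.subset_insert r μ'))
    · exact (hcross _ h _ hμ't).1 (Finset.insert_subset_insert r hsub)

end Split

/-- Hypotheses of a split family (packaged): `F = s ∪ t`, disjoint, both nonempty, no comparable
pair across. -/
structure IsSplit (F s t : Finset (Finset α)) : Prop where
  union : s ∪ t = F
  disj : Disjoint s t
  ne_s : s.Nonempty
  ne_t : t.Nonempty
  cross : ∀ a ∈ s, ∀ b ∈ t, ¬ a ⊆ b ∧ ¬ b ⊆ a

/-- A split family is not `NoSplit`. -/
theorem not_noSplit_of_isSplit {F s t : Finset (Finset α)} (h : IsSplit F s t) : ¬ NoSplit F := by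
  intro hns
  obtain ⟨a, ha, b, hb, hab⟩ := hns s t h.union h.disj h.ne_s h.ne_t
  rcases hab with hab | hab
  · exact (h.cross a ha b hb).1 hab
  · exact (h.cross a ha b hb).2 hab

/-- Swapping the sides of a split. -/
theorem IsSplit.symm {F s t : Finset (Finset α)} (h : IsSplit F s t) : IsSplit F t s :=
  ⟨by rw [Finset.union_comm]; exact h.union, h.disj.symm, h.ne_t, h.ne_s,
    fun b hb a ha => ⟨(h.cross a ha b hb).2, (h.cross a ha b hb).1⟩⟩

open Classical in
/-- The standard facts about the projection of a split family of excess one, packaged: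
the projection is tight, its difference family is down-closed, its members lie in `u.erase r`,
it is nonempty. -/
theorem proj_facts {F s t : Finset (Finset α)} (u : Finset α) (hFu : ∀ A ∈ F, A ⊆ u)
    (hsp : IsSplit F s t) (hD : IsDownSet (F \\ F)) (hexc : (F \\ F).card = F.card + 1) {r : α}
    (hr : ({r} : Finset α) ∈ F \\ F) :
    Tight (proj r F) ∧ IsDownSet (proj r F \\ proj r F) ∧ (∀ μ ∈ proj r F, μ ⊆ u.erase r) ∧
      (proj r F).Nonempty := by
  have hsplit : ¬ NoSplit F := not_noSplit_of_isSplit hsp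
  obtain ⟨hproj, -⟩ := tight_proj_of_split_excess_one u hFu hsplit hD hexc hr
  refine ⟨hproj, isDownSet_diffs_proj hD, ?_, ?_⟩
  · intro μ hμ
    obtain ⟨B, hB, rfl⟩ := mem_proj.1 hμ
    exact Finset.erase_subset_erase r (hFu B hB)
  · obtain ⟨a, ha⟩ := hsp.ne_s
    exact ⟨a.erase r, mem_proj.2 ⟨a, by rw [← hsp.union]; exact Finset.mem_union_left t ha, rfl⟩⟩

/-- The projection of a member of `t` lies on side `t`. -/
theorem onSide_erase {t : Finset (Finset α)} {r : α} {b : Finset α}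
    (hb : b ∈ t) : OnSide t r (b.erase r) := by
  by_cases hrb : r ∈ b
  · right; rw [Finset.insert_erase hrb]; exact hb
  · left; rw [Finset.erase_eq_of_notMem hrb]; exact hb

open Classical in
/-- **FACT (M), the `0`-lift case**: if the addable class `M′` of the projection has a `0`-lift
(`M′ ∈ F`) and lies on side `s`, then every member of `t` contains `r`. (If `M′` also has an
`r`-lift, `t` is empty and the conclusion is vacuous — proved as a contradiction.) -/
theorem forall_mem_of_zero_lift {F s t : Finset (Finset α)} (u : Finset α) (hFu : ∀ A ∈ F, A ⊆ u)
    (hsp : IsSplit F s t) (hD : IsDownSet (F \\ F)) (hexc : (F \\ F).card = F.card + 1) {r : α}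
    (hr : ({r} : Finset α) ∈ F \\ F)
    (hM : OnSide s r (addableSet (u.erase r) (proj r F)))
    (h0 : addableSet (u.erase r) (proj r F) ∈ F) : ∀ b ∈ t, r ∈ b := by
  obtain ⟨hproj, hD', hF'u, hF'ne⟩ := proj_facts u hFu hsp hD hexc hr
  set M := addableSet (u.erase r) (proj r F) with hMdef
  have hMmem : M ∈ proj r F := addableSet_mem hproj hD' hF'u hF'ne
  have hrule := fun {μ μ' : Finset α} (h : μ ⊆ μ') (h1 : OnSide s r μ) (h2 : OnSide t r μ') =>
    lift_rule hsp.union hsp.disj hsp.cross h h1 h2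
  have hrule' := fun {μ μ' : Finset α} (h : μ ⊆ μ') (h1 : OnSide t r μ) (h2 : OnSide s r μ') =>
    lift_rule hsp.symm.union hsp.symm.disj hsp.symm.cross h h1 h2
  intro b hb
  have hbF : b ∈ F := by rw [← hsp.union]; exact Finset.mem_union_right s hb
  have hμF' : b.erase r ∈ proj r F := mem_proj.2 ⟨b, hbF, rfl⟩
  have hμt : OnSide t r (b.erase r) := onSide_erase hb
  -- `μ ∪ M` is on side `s` (else `M ∉ F`)
  have h2 : OnSide s r (b.erase r ∪ M) := by
    rcases onSide_or_onSide hsp.union (lift_of_mem_proj (union_addableSet_mem hμF')).2 with h | h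
    · exact h
    · exact absurd h0 (hrule Finset.subset_union_right hM h).1
  have h4 := (hrule' Finset.subset_union_left hμt h2).1
  by_contra hrb
  exact h4 (by rw [Finset.erase_eq_of_notMem hrb]; exact hbF)

open Classical in
/-- **FACT (M), the `r`-lift case**: if the addable class `M′` has no `0`-lift (`M′ ∉ F`) and lies
on side `s`, then every member of `t` avoids `r`. -/
theorem forall_notMem_of_r_lift {F s t : Finset (Finset α)} (u : Finset α)
    (hFu : ∀ A ∈ F, A ⊆ u) (hsp : IsSplit F s t) (hD : IsDownSet (F \\ F))
    (hexc : (F \\ F).card = F.card + 1) {r : α} (hr : ({r} : Finset α) ∈ F \\ F)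
    (hM : OnSide s r (addableSet (u.erase r) (proj r F)))
    (h0 : addableSet (u.erase r) (proj r F) ∉ F) : ∀ b ∈ t, r ∉ b := by
  obtain ⟨hproj, hD', hF'u, hF'ne⟩ := proj_facts u hFu hsp hD hexc hr
  set M := addableSet (u.erase r) (proj r F) with hMdef
  have hMmem : M ∈ proj r F := addableSet_mem hproj hD' hF'u hF'ne
  have hr' : insert r M ∈ F := by
    rcases (lift_of_mem_proj hMmem).2 with h | h
    · exact absurd h h0
    · exact h
  have hrule := fun {μ μ' : Finset α} (h : μ ⊆ μ') (h1 : OnSide s r μ) (h2 : OnSide t r μ') =>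
    lift_rule hsp.union hsp.disj hsp.cross h h1 h2
  have hrule' := fun {μ μ' : Finset α} (h : μ ⊆ μ') (h1 : OnSide t r μ) (h2 : OnSide s r μ') =>
    lift_rule hsp.symm.union hsp.symm.disj hsp.symm.cross h h1 h2
  intro b hb
  have hbF : b ∈ F := by rw [← hsp.union]; exact Finset.mem_union_right s hb
  have hμF' : b.erase r ∈ proj r F := mem_proj.2 ⟨b, hbF, rfl⟩
  have hμt : OnSide t r (b.erase r) := onSide_erase hb
  have h1 : OnSide s r (b.erase r ∩ M) := by
    rcases onSide_or_onSide hsp.union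
        (lift_of_mem_proj (inter_addableSet_mem hproj hD' hF'u hμF')).2 with h | h
    · exact h
    · exact absurd hr' (hrule' Finset.inter_subset_right h hM).2
  have h3 := (hrule Finset.inter_subset_left h1 hμt).2
  intro hrb
  exact h3 (by rw [Finset.insert_erase hrb]; exact hbF)

open Classical in
/-- The two cases combined: the side opposite to the addable class is monochromatic at `r`. -/
theorem monochromatic_of_onSide {F s t : Finset (Finset α)} (u : Finset α) (hFu : ∀ A ∈ F, A ⊆ u)
    (hsp : IsSplit F s t) (hD : IsDownSet (F \\ F)) (hexc : (F \\ F).card = F.card + 1) {r : α}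
    (hr : ({r} : Finset α) ∈ F \\ F)
    (hM : OnSide s r (addableSet (u.erase r) (proj r F))) :
    (∀ b ∈ t, r ∈ b) ∨ (∀ b ∈ t, r ∉ b) := by
  by_cases h0 : addableSet (u.erase r) (proj r F) ∈ F
  · exact Or.inl (forall_mem_of_zero_lift u hFu hsp hD hexc hr hM h0)
  · exact Or.inr (forall_notMem_of_r_lift u hFu hsp hD hexc hr hM h0)

open Classical in
/-- **FACT (M).** In a split family `F = s ⊔ t` with a down-closed difference family, Marica–Schönheim
excess one and `{r}` a difference, one side is monochromatic at `r`. -/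
theorem monochromatic_side {F s t : Finset (Finset α)} (u : Finset α) (hFu : ∀ A ∈ F, A ⊆ u)
    (hsp : IsSplit F s t) (hD : IsDownSet (F \\ F)) (hexc : (F \\ F).card = F.card + 1) {r : α}
    (hr : ({r} : Finset α) ∈ F \\ F) :
    (∀ a ∈ s, r ∈ a) ∨ (∀ a ∈ s, r ∉ a) ∨ (∀ b ∈ t, r ∈ b) ∨ (∀ b ∈ t, r ∉ b) := by
  obtain ⟨hproj, hD', hF'u, hF'ne⟩ := proj_facts u hFu hsp hD hexc hr
  have hMmem : addableSet (u.erase r) (proj r F) ∈ proj r F := addableSet_mem hproj hD' hF'u hF'ne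
  rcases onSide_or_onSide hsp.union (lift_of_mem_proj hMmem).2 with hM | hM
  · rcases monochromatic_of_onSide u hFu hsp hD hexc hr hM with h | h
    · exact Or.inr (Or.inr (Or.inl h))
    · exact Or.inr (Or.inr (Or.inr h))
  · rcases monochromatic_of_onSide u hFu hsp.symm hD hexc hr hM with h | h
    · exact Or.inl h
    · exact Or.inr (Or.inl h)

end PercRepro.MSTight
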